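import Summits.SmoothPoincare4.SmoothPoincare4.Cruxes.CylinderRungTwo.IdeateSketchK3
import Literature.Geometry.Riemannian.SphericalCylinderEntropy

/-!
# Crux-triage r1-1 evidence (crux `CylinderRungTwo`, stmt-SmoothPoincare4-7631):
# the first lemmas A1 (`EntropyDominatesAreaRatio`, card `ground-state-relaxation`) and
# B1 (`UniqueSeparatingSheet`, card `separating-sheet-genealogy`) are TRUE — proved from the tree

Both typed first lemmas of ideator 3 (`Cruxes/CylinderRungTwo/IdeateSketchK3.lean`) follow from
`Literature.Geometry.Riemannian.SphericalCylinderEntropy` (the 7632 disprover's landed file):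
`measure_ratio_le_cylEntropy` (the `τ → ∞` end of the supremum) and
`hausdorffMeasure_sphere_le_of_separatesEnds` (area floor), once one notes that the ideator's inline
`cylEnt` IS the tree's `cylEntropy` (`rfl`).  So A1 and B1 are settled, not stubs.
-/

noncomputable section

open scoped Manifold ContDiff ENNReal Topology
open MeasureTheory Set

set_option linter.dupNamespace false

namespace Summit.SmoothPoincare4.SmoothPoincare4.Cruxes.CylinderRungTwo.Triage

open Ideator3
open Literature.Geometry.Riemannian.SphericalCylinderEntropy

/-- The ideator's inline cylinder entropy is the tree's `cylEntropy`, on the nose. -/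
theorem cylEnt_eq_cylEntropy (A : Set E6) : cylEnt A = cylEntropy A := rfl

/-- Compact subsets of `ℝ⁶` have bounded height `|z₅|`. -/
theorem exists_abs_five_le {A : Set E6} (hA : IsCompact A) : ∃ C : ℝ, ∀ z ∈ A, |z 5| ≤ C := by
  obtain ⟨C, hC⟩ := hA.isBounded.exists_norm_le
  refine ⟨C, fun z hz => ?_⟩
  calc |z 5| = ‖z 5‖ := (Real.norm_eq_abs _).symm
    _ ≤ ‖z‖ := PiLp.norm_apply_le z 5
    _ ≤ C := hC z hz

/-- **A1 holds** (`EntropyDominatesAreaRatio`, card `ground-state-relaxation`). -/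
theorem entropyDominatesAreaRatio : EntropyDominatesAreaRatio := by
  intro A hAN hAc
  rw [cylEnt_eq_cylEntropy]
  obtain ⟨C, hC⟩ := exists_abs_five_le hAc
  exact measure_ratio_le_cylEntropy hAc.isClosed.measurableSet (fun z hz => hAN hz) hC

/-- **B1 holds** (`UniqueSeparatingSheet`, card `separating-sheet-genealogy`): below cylinder
entropy `2` at most one clopen piece of a closed embedded (possibly disconnected) `M ⊂ N` separates
the ends. -/
theorem uniqueSeparatingSheet : UniqueSeparatingSheet := by
  intro M _ _ _ _ _ _ ι hι hN hent A B hA hB hAB hsA hsB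
  have hinj : Function.Injective ι := hι.isEmbedding.injective
  have hcont : Continuous ι := hι.isEmbedding.continuous
  have hmB : MeasurableSet (ι '' B) := (hB.isClosed.isCompact.image hcont).isClosed.measurableSet
  have hdisj : Disjoint (ι '' A) (ι '' B) := (Set.disjoint_image_iff hinj).2 hAB
  obtain ⟨RA, hRA⟩ := hsA
  obtain ⟨RB, hRB⟩ := hsB
  have hfloorA : μH[4] (Metric.sphere (0 : EuclideanSpace ℝ (Fin 5)) 1) ≤ μH[4] (ι '' A) :=
    hausdorffMeasure_sphere_le_of_separatesEnds hRA
  have hfloorB : μH[4] (Metric.sphere (0 : EuclideanSpace ℝ (Fin 5)) 1) ≤ μH[4] (ι '' B) :=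
    hausdorffMeasure_sphere_le_of_separatesEnds hRB
  have hunion : ι '' A ∪ ι '' B ⊆ Set.range ι :=
    union_subset (image_subset_range _ _) (image_subset_range _ _)
  have h2 : 2 * μH[4] (Metric.sphere (0 : EuclideanSpace ℝ (Fin 5)) 1) ≤ μH[4] (Set.range ι) :=
    calc 2 * μH[4] (Metric.sphere (0 : EuclideanSpace ℝ (Fin 5)) 1)
        = μH[4] (Metric.sphere (0 : EuclideanSpace ℝ (Fin 5)) 1) +
            μH[4] (Metric.sphere (0 : EuclideanSpace ℝ (Fin 5)) 1) := two_mul _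
      _ ≤ μH[4] (ι '' A) + μH[4] (ι '' B) := add_le_add hfloorA hfloorB
      _ = μH[4] (ι '' A ∪ ι '' B) := (measure_union hdisj hmB).symm
      _ ≤ μH[4] (Set.range ι) := measure_mono hunion
  have hrange_c : IsCompact (Set.range ι) := isCompact_range hcont
  obtain ⟨C, hC⟩ := exists_abs_five_le hrange_c
  have hratio := measure_ratio_le_cylEntropy hrange_c.isClosed.measurableSet
    (fun z hz => by obtain ⟨x, rfl⟩ := hz; exact hN x) hC
  have htwo : (2 : ℝ≥0∞) ≤ cylEnt (Set.range ι) := by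
    rw [cylEnt_eq_cylEntropy]
    calc (2 : ℝ≥0∞) = (μH[4] (Metric.sphere (0 : EuclideanSpace ℝ (Fin 5)) 1))⁻¹ *
          (2 * μH[4] (Metric.sphere (0 : EuclideanSpace ℝ (Fin 5)) 1)) := by
          rw [mul_comm (2 : ℝ≥0∞), ← mul_assoc, ENNReal.inv_mul_cancel
            hausdorffMeasure_sphere_four_pos.ne' hausdorffMeasure_sphere_four_lt_top.ne, one_mul]
      _ ≤ (μH[4] (Metric.sphere (0 : EuclideanSpace ℝ (Fin 5)) 1))⁻¹ * μH[4] (Set.range ι) := by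
          gcongr
      _ ≤ cylEntropy (Set.range ι) := hratio
  exact absurd hent (not_lt.2 htwo)

end Summit.SmoothPoincare4.SmoothPoincare4.Cruxes.CylinderRungTwo.Triage
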